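import Mathlib.Analysis.SpecialFunctions.Complex.LogBounds
import Mathlib.LinearAlgebra.Matrix.Charpoly.Eigs
import Literature.Analysis.InnerProduct.SchurInequality
import Literature.LinearAlgebra.Matrix.TraceAevalRoots

/-!
# Second-order log-determinant bound `log |det (1 + X)| ≤ Re tr X − Re tr X² / 2 + n r³ / (3 (1 − r))`
(helper for crux stmt-QuantumFields-9734, line `Sketch`, static route, stub `stub_heavyFrequencyGain`,
Route B step B6 — the matrix lemma of the cell analysis)

For a complex `n × n` matrix `X` whose spectrum lies in the closed disc of radius `r < 1`:
`det (1 + X) ≠ 0` and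
`log |det (1 + X)| ≤ Re tr X − Re tr (X X) / 2 + n · r³ / (3 (1 − r))`.

Proof.  Over `ℂ` the characteristic polynomial splits; let `λ₁, …, λₙ` be its roots with multiplicity
(all in the spectrum, hence `|λᵢ| ≤ r`).  Then `det (1 + X) = ∏ (1 + λᵢ)`
(`Literature.Analysis.InnerProduct.matrix_det_one_add_eq_prod_roots_charpoly`), `tr X = Σ λᵢ`
(`Matrix.trace_eq_sum_roots_charpoly`) and `tr X² = Σ λᵢ²`
(`Literature.LinearAlgebra.Matrix.matrix_trace_aeval_eq_sum_roots_charpoly` with `g = X²`).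
For a single `z` with `|z| ≤ r < 1`, `1 + z ≠ 0` and the Taylor remainder estimate of the complex logarithm
(`Complex.norm_log_sub_logTaylor_le 2`: `‖log (1 + z) − (z − z²/2)‖ ≤ |z|³ / (3 (1 − |z|))`) gives
`log |1 + z| = Re log (1 + z) ≤ Re z − Re z² / 2 + r³ / (3 (1 − r))`; sum over the roots.
-/

namespace Summit.QuantumFields.QCD.Cruxes.CriticalLineDiamagnetism.ChessboardCellGain

open Matrix

/-- Scalar second-order bound: for `‖z‖ ≤ r < 1`, `1 + z ≠ 0` and
`log ‖1 + z‖ ≤ Re z − Re z² / 2 + r³ / (3 (1 − r))`. -/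
theorem log_norm_one_add_le_secondOrder {z : ℂ} {r : ℝ} (hr1 : r < 1) (hz : ‖z‖ ≤ r) :
    1 + z ≠ 0 ∧ Real.log ‖1 + z‖ ≤ z.re - (z ^ 2).re / 2 + r ^ 3 / (3 * (1 - r)) := by
  have hz1 : ‖z‖ < 1 := hz.trans_lt hr1
  have hne : 1 + z ≠ 0 := by
    intro h
    have h' : z = -1 := by linear_combination h
    rw [h', norm_neg, norm_one] at hz1
    exact lt_irrefl _ hz1
  refine ⟨hne, ?_⟩
  -- the Taylor polynomial of order two
  have hT : Complex.logTaylor 3 z = z - z ^ 2 / 2 := by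
    simp [Complex.logTaylor, Finset.sum_range_succ]
    ring
  -- the remainder estimate
  have hb : ‖Complex.log (1 + z) - (z - z ^ 2 / 2)‖ ≤ ‖z‖ ^ 3 * (1 - ‖z‖)⁻¹ / 3 := by
    have h := Complex.norm_log_sub_logTaylor_le 2 hz1
    norm_num at h
    rwa [hT] at h
  have hre : (Complex.log (1 + z)).re ≤ z.re - (z ^ 2).re / 2 + ‖z‖ ^ 3 * (1 - ‖z‖)⁻¹ / 3 := by
    have h1 : (Complex.log (1 + z) - (z - z ^ 2 / 2)).re ≤ ‖z‖ ^ 3 * (1 - ‖z‖)⁻¹ / 3 :=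
      (Complex.re_le_norm _).trans hb
    have h2 : (Complex.log (1 + z) - (z - z ^ 2 / 2)).re =
        (Complex.log (1 + z)).re - (z.re - (z ^ 2).re / 2) := by
      simp [Complex.sub_re]
    linarith [h1, h2]
  -- monotonicity of the remainder bound in `‖z‖ ≤ r`
  have hmono : ‖z‖ ^ 3 * (1 - ‖z‖)⁻¹ / 3 ≤ r ^ 3 / (3 * (1 - r)) := by
    have h1r : 0 < 1 - r := sub_pos.mpr hr1
    have hz0 : 0 ≤ ‖z‖ := norm_nonneg z
    have hA : ‖z‖ ^ 3 ≤ r ^ 3 := pow_le_pow_left₀ hz0 hz 3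
    have hB : (1 - ‖z‖)⁻¹ ≤ (1 - r)⁻¹ := inv_anti₀ h1r (by linarith)
    have hC : 0 ≤ (1 - ‖z‖)⁻¹ := inv_nonneg.mpr (by linarith)
    have hD : 0 ≤ r ^ 3 := pow_nonneg (hz0.trans hz) 3
    have hne' : (1 - r) ≠ 0 := h1r.ne'
    calc ‖z‖ ^ 3 * (1 - ‖z‖)⁻¹ / 3 ≤ r ^ 3 * (1 - r)⁻¹ / 3 :=
          div_le_div_of_nonneg_right (mul_le_mul hA hB hC hD) (by norm_num)
      _ = r ^ 3 / (3 * (1 - r)) := by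
          field_simp
  rw [Complex.log_re] at hre
  linarith [hre, hmono]

/-- Multiset form: if every `μ ∈ s` has `1 + μ ≠ 0` and `log ‖1 + μ‖ ≤ Re μ − Re μ² / 2 + t`, then
`∏ (1 + μ) ≠ 0` and `log ‖∏ (1 + μ)‖ ≤ Re Σ μ − Re Σ μ² / 2 + (card s) · t`. -/
theorem log_norm_multiset_prod_one_add_le (s : Multiset ℂ) (t : ℝ)
    (hs : ∀ μ ∈ s, 1 + μ ≠ 0 ∧ Real.log ‖1 + μ‖ ≤ μ.re - (μ ^ 2).re / 2 + t) :
    (s.map fun μ => 1 + μ).prod ≠ 0 ∧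
      Real.log ‖(s.map fun μ => 1 + μ).prod‖ ≤
        s.sum.re - (s.map fun μ => μ ^ 2).sum.re / 2 + (Multiset.card s : ℝ) * t := by
  induction s using Multiset.induction_on with
  | empty => simp
  | cons a s ih =>
    obtain ⟨hane, hale⟩ := hs a (Multiset.mem_cons_self a s)
    obtain ⟨hsne, hsle⟩ := ih (fun μ hμ => hs μ (Multiset.mem_cons_of_mem hμ))
    simp only [Multiset.map_cons, Multiset.prod_cons, Multiset.sum_cons, Multiset.card_cons]
    refine ⟨mul_ne_zero hane hsne, ?_⟩
    rw [norm_mul, Real.log_mul (norm_ne_zero_iff.mpr hane) (norm_ne_zero_iff.mpr hsne),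
      Complex.add_re, Complex.add_re]
    push_cast
    linarith

/-- **Second-order log-determinant bound.**  If the spectrum of `X : Matrix k k ℂ` lies in the closed
disc of radius `r < 1`, then `det (1 + X) ≠ 0` and
`log ‖det (1 + X)‖ ≤ Re tr X − Re tr (X X) / 2 + (card k) r³ / (3 (1 − r))`. -/
theorem logDetSecondOrder : ∀ {k : Type} [Fintype k] [DecidableEq k] (X : Matrix k k ℂ) (r : ℝ), 0 ≤ r → r < 1 → (∀ μ : ℂ, μ ∈ spectrum ℂ X → ‖μ‖ ≤ r) → (1 + X).det ≠ 0 ∧ Real.log ‖(1 + X).det‖ ≤ X.trace.re - (X * X).trace.re / 2 + (Fintype.card k : ℝ) * r ^ 3 / (3 * (1 - r)) := by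
  intro k _ _ X r _ hr1 hspec
  -- the roots of the characteristic polynomial, with multiplicity
  have hroots : ∀ μ ∈ X.charpoly.roots,
      1 + μ ≠ 0 ∧ Real.log ‖1 + μ‖ ≤ μ.re - (μ ^ 2).re / 2 + r ^ 3 / (3 * (1 - r)) :=
    fun μ hμ => log_norm_one_add_le_secondOrder hr1 (hspec μ
      (Matrix.mem_spectrum_of_isRoot_charpoly ((Polynomial.mem_roots X.charpoly_monic.ne_zero).mp hμ)))
  have hdet : (1 + X).det = (X.charpoly.roots.map fun μ => 1 + μ).prod :=
    Literature.Analysis.InnerProduct.matrix_det_one_add_eq_prod_roots_charpoly X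
  have htr : X.trace = X.charpoly.roots.sum := Matrix.trace_eq_sum_roots_charpoly X
  have htr2 : (X * X).trace = (X.charpoly.roots.map fun μ => μ ^ 2).sum := by
    have h := Literature.LinearAlgebra.Matrix.matrix_trace_aeval_eq_sum_roots_charpoly X
      ((Polynomial.X : Polynomial ℂ) ^ 2)
    simp only [map_pow, Polynomial.aeval_X, Polynomial.eval_pow, Polynomial.eval_X] at h
    rw [← sq]
    exact h
  have hcard : Multiset.card X.charpoly.roots = Fintype.card k := by
    rw [← (IsAlgClosed.splits X.charpoly).natDegree_eq_card_roots, Matrix.charpoly_natDegree_eq_dim]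
  obtain ⟨hne, hle⟩ :=
    log_norm_multiset_prod_one_add_le X.charpoly.roots (r ^ 3 / (3 * (1 - r))) hroots
  rw [hdet, htr, htr2, ← hcard, mul_div_assoc]
  exact ⟨hne, hle⟩

end Summit.QuantumFields.QCD.Cruxes.CriticalLineDiamagnetism.ChessboardCellGain
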